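import Literature.AnabelianGeometry.SemiGraphs.PSCSeparatingCoveringsTwoComponentAffine
import HarnessLib

/-!
# [CombGC] Prop. 1.2, proof p. 9: EDGE-LIKE separating coverings at the genuine two-component affine data (row F-2827; F-2829, edge conjunct)

Mochizuki, *A combinatorial version of the Grothendieck conjecture*, Tohoku Math. J. **59** (2007)
[CombGC], PROOF of Proposition 1.2, author's manuscript p. 9, the resp'd (edge) case: "respectively,
`e₁ ≠ e₂` … there exists a finite étale … `Π_G`-covering `G' → G` whose restriction to the anabelioid
`G_{e₂}` is trivial, but whose restriction to the anabelioid `G_{e₁}` is nontrivial"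
[cite: MochizukiCombGC2007, Prop 1.2 proof p.9].  Typed LEVEL-WISE as
`PSCDatum.EdgeLikeSeparatingCoverings` (abc-iut-w4-d081, `PSCSeparatingCoverings.lean`, row P12-L01-E;
abc-iut FACT-LIST row F-2827, the edge conjunct of F-2829 / F-2830; universal closure refuted; instance
forms so far only at NODELESS data — `PSCSeparatingCoveringsSmoothCurve.lean`).

PROOF-ONLY file (abc-iut-f-166 gen 3), companion of `PSCSeparatingCoveringsTwoComponentAffine.lean`
(the verticial conjunct).  Edge groups of a datum over a pro-`Σ` completion `ι : Γ → Π` of a FREE group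
are closures of RANK-ONE FREE FACTORS whenever their generators belong to free bases of `Γ`; then the
two free-factor theorems give the edge clause uniformly:

* `edgeLikeSeparatingCoverings_of_rankOneFreeFactors` — the ENGINE: if every edge group is
  `cl ι⟨x_e⟩` with `x_e` a member of SOME free basis of `Γ`, and for `e₁ ≠ e₂` some character of `Γ` kills
  `x_{e₂}` but not `x_{e₁}`, then `G.EdgeLikeSeparatingCoverings` (`V' := V`): two level edges over the
  SAME edge by the fibred twist (`freeFactor_exists_open_separating_sameVertex`), over DIFFERENT edges by
  the projection killing `x_{e₂}` (`freeFactor_exists_open_separating_crossVertex`; the character shows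
  that `x_{e₁}` survives it, since a character killing the killed letter factors through the projection);
* `edgeLikeSeparatingCoverings_of_twoComponentAffine` — **row F-2827 at the genuine two-component affine
  data of abc-iut-f-164** (ONE NODE `ν` with `Π_ν = cl ι⟨ε⟩`, `ε` the node loop — a member of the node-loop
  free basis of `PuncturedSurfaceGroupNodeLoopBasis.lean`; cusps `Π_{c_j} = cl ι⟨c_j⟩`, every `c_j` a
  member of a free basis, `PuncturedSurfaceGroupCuspBases.exists_freeGroupBasis_eq_c`); the separating
  characters are abc-iut-f-164's cusp characters `δ_k − δ_m` (`exists_handleCuspCharacter`,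
  `character_nodeLoop`: the node loop has `C₀`-weight `∑_{s≤j} wc_j`), with `ℤ/3` coefficients;
* `exists_twoComponentAffine_edgeLikeSeparatingCoverings` — non-vacuity at an inhabited datum with a node
  and four cusps (`i = 2`, `n = 1`, `r = 4`).

First instance of the edge clause at data WITH A NODE.  A shape instance is consistency evidence for the
typed schema, not the printed statement for all pointed stable curves; the `Π^unr` conjunct is not
treated.  0 definitions; nothing here takes a side on [IUTchIII] Cor. 3.12.
-/

noncomputable section

namespace Literature.AnabelianGeometry.SemiGraphs

namespace PSCDatum

open scoped Pointwise
open Multiplicative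
open Literature.GroupTheory.CombinatorialGroupTheory
open Literature.GroupTheory.CombinatorialGroupTheory.PuncturedSurfaceGroup (a b c cuspInertia
  exists_freeGroupBasis_nodeLoop exists_freeGroupBasis_eq_c exists_handleCuspCharacter)
open Literature.GroupTheory.CombinatorialGroupTheory.FreeFactorFibredTwist (lift_apply_basis)
open SemiGraphOfAnabelioids (IsProSigmaCompletion)
open SemiGraphOfAnabelioids.IsProSigmaCompletion (freeFactor_exists_open_separating_sameVertex
  freeFactor_exists_open_separating_crossVertex)

universe u

/-! ### The engine: edge groups that are closures of rank-one free factors -/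

section Engine

variable {Sigma : Set ℕ} {Γ : Type u} [Group Γ] {P : Type u} [Group P] [TopologicalSpace P]
  [IsTopologicalGroup P] [CompactSpace P] [TotallyDisconnectedSpace P] {ι : Γ →* P}

/-- **Edge-like separating coverings from rank-one free factors** ([CombGC] Prop. 1.2 proof p. 9, edge
case, free-factor form).  `ι : Γ → Π` a profinite pro-`Σ` completion (`Σ ∋` a prime); every edge group
`Π_e = cl ι⟨x_e⟩` with `x_e` a member of some free basis of `Γ`; for `e₁ ≠ e₂` a homomorphism
`χ : Γ → M` with `χ(x_{e₂}) = 1 ≠ χ(x_{e₁})`.  Then `G.EdgeLikeSeparatingCoverings` holds, with `V' := V`.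
[cite: MochizukiCombGC2007, Prop 1.2 proof p.9] -/
theorem edgeLikeSeparatingCoverings_of_rankOneFreeFactors (hι : IsProSigmaCompletion Sigma ι)
    (hSig : ∃ ℓ ∈ Sigma, ℓ.Prime) (G : PSCDatum P) (xs : G.graph.N ⊕ G.graph.C → Γ)
    (hx : ∀ e, G.edgeGp e = ((Subgroup.zpowers (xs e)).map ι).topologicalClosure)
    (hfac : ∀ e, ∃ (κ : Type) (bκ : FreeGroupBasis κ Γ) (k : κ), bκ k = xs e)
    {M : Type*} [Group M]
    (hsep : ∀ e₁ e₂, e₁ ≠ e₂ → ∃ χ : Γ →* M, χ (xs e₂) = 1 ∧ χ (xs e₁) ≠ 1) :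
    G.EdgeLikeSeparatingCoverings := by
  classical
  obtain ⟨ℓ, hℓS, hℓ⟩ := hSig
  intro V hVn hVo
  haveI := hVn
  refine ⟨V, hVn, hVo, le_rfl, fun e₁ e₂ γ₁ γ₂ hne12 => ?_⟩
  have hform : ∀ e (κ : Type) (bκ : FreeGroupBasis κ Γ) (k : κ), bκ k = xs e →
      G.edgeGp e = ((Subgroup.closure (bκ '' {k})).map ι).topologicalClosure := by
    intro e κ bκ k hk
    rw [hx e, Set.image_singleton, hk, Subgroup.zpowers_eq_closure]
  by_cases h : e₁ = e₂
  · subst h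
    obtain ⟨κ, bκ, k, hk⟩ := hfac e₁
    exact freeFactor_exists_open_separating_sameVertex hι bκ {k} (Set.singleton_nonempty k) hℓ hℓS
      (G.edgeGp e₁) (hform e₁ κ bκ k hk) V hVo γ₁ γ₂ (hne12.resolve_left fun hn => hn rfl)
  · obtain ⟨κ, bκ, k, hk⟩ := hfac e₂
    obtain ⟨χ, hχ2, hχ1⟩ := hsep e₁ e₂ h
    let ρ : Γ →* Γ := bκ.lift fun j => if j ∈ ({k} : Set κ) then 1 else bκ j
    have hρ : ∀ j, ρ (bκ j) = if j ∈ ({k} : Set κ) then 1 else bκ j := fun j => lift_apply_basis bκ _ j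
    have hρx : ρ (xs e₁) ≠ 1 := by
      have hcomp : χ.comp ρ = χ := bκ.ext_hom _ _ fun j => by
        rw [MonoidHom.comp_apply, hρ j]
        by_cases hj : j ∈ ({k} : Set κ)
        · rw [if_pos hj, map_one, Set.mem_singleton_iff.mp hj, hk, hχ2]
        · rw [if_neg hj]
      intro h1
      apply hχ1
      rw [← hcomp, MonoidHom.comp_apply, h1, map_one]
    have hxA : ι (xs e₁) ∈ G.edgeGp e₁ := by
      rw [hx e₁]
      exact Subgroup.le_topologicalClosure _ (Subgroup.mem_map_of_mem ι (Subgroup.mem_zpowers _))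
    exact freeFactor_exists_open_separating_crossVertex hι ⟨ℓ, hℓS, hℓ⟩ bκ {k} ρ hρ (G.edgeGp e₂)
      (hform e₂ κ bκ k hk) (G.edgeGp e₁) (xs e₁) hxA hρx V hVo γ₁ γ₂

end Engine

/-! ### The two-component affine data -/

section TwoComponentAffine

open TwoComponentAffine (character_nodeLoop sum_ite_twoDelta sum_twoDelta)

variable {P : Type} [Group P] [TopologicalSpace P] [IsTopologicalGroup P]
variable [CompactSpace P] [TotallyDisconnectedSpace P] {Sigma : Set ℕ} {g r : ℕ}

/-- `ofAdd 1 ≠ 1` in `ℤ/3`. [cite: MochizukiCombGC2007, Prop 1.2 proof p.9] -/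
private theorem ofAdd_one_ne_one_zmod3 : (ofAdd (1 : ZMod 3) : Multiplicative (ZMod 3)) ≠ 1 := by
  intro h
  have h1 : (1 : ZMod 3) = 0 := Multiplicative.ofAdd.injective (h.trans ofAdd_zero.symm)
  exact absurd h1 (by decide)

/-- Three pairwise constraints leave room in `Fin r`, `r ≥ 3`: an index different from two given ones.
[cite: MochizukiCombGC2007, Prop 1.2 proof p.9] -/
private theorem exists_ne_ne (hr : 3 ≤ r) (k₁ k₂ : Fin r) : ∃ m : Fin r, m ≠ k₁ ∧ m ≠ k₂ := by
  classical
  by_contra h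
  push Not at h
  have hsub : (Finset.univ : Finset (Fin r)) ⊆ {k₁, k₂} := fun m _ => by
    rcases eq_or_ne m k₁ with h1 | h1
    · simp [h1]
    · simp [h m h1]
  have hcard := Finset.card_le_card hsub
  rw [Finset.card_univ, Fintype.card_fin] at hcard
  have h2 : ({k₁, k₂} : Finset (Fin r)).card ≤ 2 := Finset.card_le_two
  omega

/-- **The cusp characters `δ_k − δ_m` of `Γ_{g,r}`** (abc-iut-f-164's `exists_handleCuspCharacter` with
`ℤ/3` coefficients): for `k ≠ m` a homomorphism `χ : Γ_{g,r} → ℤ/3` with `χ(c_k) = 1̄`, `χ(c_m) = −1̄`,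
`χ(c_j) = 0̄` otherwise, whose value on the node loop `ε` is `[s ≤ k] − [s ≤ m]`.
[cite: MochizukiCombGC2007, Prop 1.2 proof p.9] -/
private theorem exists_twoDelta_character (g₀ s : ℕ) (k m : Fin r) (ε : PuncturedSurfaceGroup g r)
    (hε : ε = ((List.finRange r).map fun j : Fin r =>
          if s ≤ (j : ℕ) then PuncturedSurfaceGroup.c (g := g) j else 1).prod *
        ((List.finRange g).map fun i : Fin g => if (i : ℕ) < g₀ then
          PuncturedSurfaceGroup.a (r := r) i * PuncturedSurfaceGroup.b i *
            (PuncturedSurfaceGroup.a i)⁻¹ * (PuncturedSurfaceGroup.b i)⁻¹ else 1).prod) :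
    ∃ χ : PuncturedSurfaceGroup g r →* Multiplicative (ZMod 3),
      (∀ j : Fin r, χ (c j) =
        ofAdd ((if j = k then (1 : ZMod 3) else 0) + (if j = m then (-1 : ZMod 3) else 0))) ∧
      χ ε = ofAdd ((if s ≤ (k : ℕ) then (1 : ZMod 3) else 0) + (if s ≤ (m : ℕ) then (-1 : ZMod 3) else 0)) := by
  classical
  obtain ⟨χ, -, -, hc⟩ := exists_handleCuspCharacter (g := g) (r := r) (n := 3) (fun _ => 0) (fun _ => 0)
    (fun j => (if j = k then (1 : ZMod 3) else 0) + (if j = m then (-1 : ZMod 3) else 0))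
    (sum_twoDelta k m)
  refine ⟨χ, hc, ?_⟩
  rw [hε, character_nodeLoop χ hc g₀ s, sum_ite_twoDelta]

/-- **Row F-2827 `EdgeLikeSeparatingCoverings` (edge conjunct of F-2829) at the genuine two-component
affine data** of abc-iut-f-164 (`s ≥ 2` cusps on `C₁`, `r − s ≥ 2` on `C₀`, one node `ν` with
`Π_ν = cl ι⟨ε⟩`, cusp groups the closed cusp inertia groups; `Π` profinite in `Type`): for every open
normal `V` and any two DISTINCT level-`V` edges there is an open `U ≤ V` (`V' := V`), normal in `V`,
trivial over the second and nontrivial over the first — node/node, node/cusp, cusp/node and cusp/cusp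
pairs alike. [cite: MochizukiCombGC2007, Prop 1.2 proof p.9] -/
theorem edgeLikeSeparatingCoverings_of_twoComponentAffine (hne : Sigma.Nonempty)
    (hprime : ∀ p ∈ Sigma, p.Prime) (ι : PuncturedSurfaceGroup g r →* P)
    (hι : IsProSigmaCompletion Sigma ι) (G : PSCDatum P) {g₀ s : ℕ} (hs : 2 ≤ s) (hsr : s + 2 ≤ r)
    (e : G.graph.C ≃ Fin r)
    (hC : ∀ c, G.cuspGp c = ((cuspInertia (g := g) (e c)).map ι).topologicalClosure)
    (n₀ : G.graph.N) (hN : ∀ n, n = n₀) (ε : PuncturedSurfaceGroup g r)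
    (hε : ε = ((List.finRange r).map fun j : Fin r =>
          if s ≤ (j : ℕ) then PuncturedSurfaceGroup.c (g := g) j else 1).prod *
        ((List.finRange g).map fun i : Fin g => if (i : ℕ) < g₀ then
          PuncturedSurfaceGroup.a (r := r) i * PuncturedSurfaceGroup.b i *
            (PuncturedSurfaceGroup.a i)⁻¹ * (PuncturedSurfaceGroup.b i)⁻¹ else 1).prod)
    (hE : G.nodeGp n₀ = ((Subgroup.zpowers ε).map ι).topologicalClosure) :
    G.EdgeLikeSeparatingCoverings := by
  classical
  have hSig : ∃ ℓ ∈ Sigma, ℓ.Prime := by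
    obtain ⟨ℓ, hℓ⟩ := hne
    exact ⟨ℓ, hℓ, hprime ℓ hℓ⟩
  -- the generators of the edge groups
  let xs : G.graph.N ⊕ G.graph.C → PuncturedSurfaceGroup g r := Sum.elim (fun _ => ε) fun c' => c (e c')
  have hx : ∀ e', G.edgeGp e' = ((Subgroup.zpowers (xs e')).map ι).topologicalClosure := by
    rintro (n | c')
    · change G.nodeGp n = ((Subgroup.zpowers ε).map ι).topologicalClosure
      rw [hN n, hE]
    · exact hC c'
  -- every generator is a member of a free basis
  have hfac : ∀ e', ∃ (κ : Type) (bκ : FreeGroupBasis κ (PuncturedSurfaceGroup g r)) (k : κ),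
      bκ k = xs e' := by
    rintro (n | c')
    · obtain ⟨r', rfl⟩ : ∃ r', r = r' + 1 := ⟨r - 1, by omega⟩
      obtain ⟨b₁, -, -, -, hk₁⟩ := exists_freeGroupBasis_nodeLoop g r' g₀ s (by omega) (by omega) ε hε
      exact ⟨_, b₁, _, hk₁⟩
    · obtain ⟨β, bs, k, hk⟩ := exists_freeGroupBasis_eq_c (g := g) (by omega : 2 ≤ r) (e c')
      exact ⟨β, bs, k, hk⟩
  -- the separating characters
  have hsep : ∀ e₁ e₂, e₁ ≠ e₂ → ∃ χ : PuncturedSurfaceGroup g r →* Multiplicative (ZMod 3),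
      χ (xs e₂) = 1 ∧ χ (xs e₁) ≠ 1 := by
    rintro (n₁ | c₁) (n₂ | c₂) hne12
    · -- node / node: there is only one node
      exact absurd (by rw [hN n₁, hN n₂]) hne12
    · -- alive: the node; killed: the cusp `k₂`
      set k₂ := e c₂ with hk₂
      -- a cusp `k ≠ k₂` on `C₀` and a cusp `m ≠ k₂` on `C₁`
      obtain ⟨k, hks, hkk₂⟩ : ∃ k : Fin r, s ≤ (k : ℕ) ∧ k ≠ k₂ := by
        by_cases h : k₂ = ⟨s, by omega⟩
        · exact ⟨⟨s + 1, by omega⟩, by simp only; omega, fun h' => by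
            rw [h] at h'; exact absurd (congrArg Fin.val h') (by simp)⟩
        · exact ⟨⟨s, by omega⟩, le_rfl, fun h' => h h'.symm⟩
      obtain ⟨m, hms, hmk₂⟩ : ∃ m : Fin r, (m : ℕ) < s ∧ m ≠ k₂ := by
        by_cases h : k₂ = ⟨0, by omega⟩
        · exact ⟨⟨1, by omega⟩, by simp only; omega, fun h' => by
            rw [h] at h'; exact absurd (congrArg Fin.val h') (by simp)⟩
        · exact ⟨⟨0, by omega⟩, by simp only; omega, fun h' => h h'.symm⟩
      obtain ⟨χ, hχc, hχε⟩ := exists_twoDelta_character g₀ s k m ε hε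
      refine ⟨χ, ?_, ?_⟩
      · change χ (c k₂) = 1
        rw [hχc, if_neg hkk₂.symm, if_neg hmk₂.symm, add_zero, ofAdd_zero]
      · change χ ε ≠ 1
        rw [hχε, if_pos hks, if_neg (by omega), add_zero]
        exact ofAdd_one_ne_one_zmod3
    · -- alive: the cusp `k₁`; killed: the node
      set k₁ := e c₁ with hk₁
      -- a second cusp `m ≠ k₁` on the same component as `k₁`
      obtain ⟨m, hmk₁, hside⟩ : ∃ m : Fin r, m ≠ k₁ ∧ (s ≤ (m : ℕ) ↔ s ≤ (k₁ : ℕ)) := by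
        by_cases hk : s ≤ (k₁ : ℕ)
        · by_cases h : k₁ = ⟨s, by omega⟩
          · exact ⟨⟨s + 1, by omega⟩, fun h' => by
              rw [h] at h'; exact absurd (congrArg Fin.val h') (by simp), by simp only; omega⟩
          · exact ⟨⟨s, by omega⟩, fun h' => h h'.symm, by simp only; omega⟩
        · by_cases h : k₁ = ⟨0, by omega⟩
          · exact ⟨⟨1, by omega⟩, fun h' => by
              rw [h] at h'; exact absurd (congrArg Fin.val h') (by simp), by simp only; omega⟩
          · exact ⟨⟨0, by omega⟩, fun h' => h h'.symm, by simp only; omega⟩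
      obtain ⟨χ, hχc, hχε⟩ := exists_twoDelta_character g₀ s k₁ m ε hε
      refine ⟨χ, ?_, ?_⟩
      · change χ ε = 1
        rw [hχε]
        by_cases hk : s ≤ (k₁ : ℕ)
        · rw [if_pos hk, if_pos (hside.mpr hk), add_neg_cancel, ofAdd_zero]
        · rw [if_neg hk, if_neg (fun h => hk (hside.mp h)), add_zero, ofAdd_zero]
      · change χ (c k₁) ≠ 1
        rw [hχc, if_pos rfl, if_neg hmk₁.symm, add_zero]
        exact ofAdd_one_ne_one_zmod3
    · -- cusp / cusp, `k₁ ≠ k₂`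
      set k₁ := e c₁ with hk₁
      set k₂ := e c₂ with hk₂
      have hk12 : k₁ ≠ k₂ := fun h => hne12 (by rw [e.injective h])
      obtain ⟨m, hmk₁, hmk₂⟩ := exists_ne_ne (by omega : 3 ≤ r) k₁ k₂
      obtain ⟨χ, hχc, -⟩ := exists_twoDelta_character g₀ s k₁ m ε hε
      refine ⟨χ, ?_, ?_⟩
      · change χ (c k₂) = 1
        rw [hχc, if_neg hk12.symm, if_neg hmk₂.symm, add_zero, ofAdd_zero]
      · change χ (c k₁) ≠ 1
        rw [hχc, if_pos rfl, if_neg hmk₁.symm, add_zero]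
        exact ofAdd_one_ne_one_zmod3
  exact G.edgeLikeSeparatingCoverings_of_rankOneFreeFactors hι hSig xs hx hfac hsep

/-- **Non-vacuity: an inhabited genuine two-component affine datum (one node, four cusps) with edge-like
AND verticial separating coverings.** [cite: MochizukiCombGC2007, Prop 1.2 proof p.9] -/
theorem exists_twoComponentAffine_edgeLikeSeparatingCoverings (Sigma : Set ℕ) (hne : Sigma.Nonempty)
    (hprime : ∀ p ∈ Sigma, p.Prime) :
    ∃ (Q : ProfiniteGrp.{0}) (G : PSCDatum Q), G.Sigma = Sigma ∧ G.graph.i = 2 ∧ G.graph.n = 1 ∧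
      G.graph.r = 4 ∧ G.EdgeLikeSeparatingCoverings ∧ G.VerticialSeparatingCoverings := by
  obtain ⟨Q, ι, G, e, v₀, v₁, n₀, ε, hι, hSg, hi, hn, hr, hC, hV, hN, hε, hV₀, hV₁, hE, -⟩ :=
    exists_twoComponentAffineDatum Sigma hne hprime 2 4 1 2
  exact ⟨Q, G, hSg, hi, hn, hr,
    G.edgeLikeSeparatingCoverings_of_twoComponentAffine hne hprime ι hι (g₀ := 1) (s := 2) le_rfl le_rfl
      e hC n₀ hN ε hε hE,
    G.verticialSeparatingCoverings_of_twoComponentAffine hne hprime ι hι (g₀ := 1) (s := 2) le_rfl le_rfl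
      v₀ v₁ hV ε hε hV₀ hV₁⟩

end TwoComponentAffine

end PSCDatum

end Literature.AnabelianGeometry.SemiGraphs

end
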